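import Literature.Barriers.CriticalPhenomena.IsingTrivialityFromDimensionFourProofs
import Literature.Barriers.CriticalPhenomena.LongRangeTrivialityOnZ3LeeYang
import Literature.Probability.LatticeModels.IsingLimitLawNewmanProofs
import Literature.Probability.LatticeModels.CriticalCorrWellDefined
import Literature.Probability.LatticeModels.PlusMinusStateGibbs
import Literature.Probability.LatticeModels.TwistCorr

/-!
# The critical block-spin law is a Lee–Yang pmf (stub `stub_blockLaw`, line `SketchPub`)

Crux `CoulombImpliesNontrivial` of route `PerfectScreening` (Ising3DConformalLimit), registered stub S1a.
For a finite block `B ⊂ ℤ^d`, the block spin `M_B = Σ_{x ∈ B} σ_x` is an integer in `[-|B|, |B|]` of the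
parity of `|B|`, so `f(M_B) = Σ_k 1{M_B = k} f(k)`; in the plus state (an integral on local observables,
`plusExpect_spinFun_eq_integral`) this gives the pmf `p_k = ⟨1{M_B = k}⟩⁺`, symmetric when `m*(β) = 0`
(odd plus correlations vanish). LEE–YANG: a free box `Λ ⊇ B` with the complex field `z·1_B` is a
ferromagnetic pair-interaction system (`isingFieldPartition`, via `NewmanLeeYang.cfgEquiv`), zero-free off
the imaginary axis by `lee_yang_ising_holds`; at `β_c(3)` the free boxes converge to the plus state
(`m*(β_c) = 0`, `hasBoxLimit_isingCorr_of_spontaneousMagnetization_eq_zero`), and Hurwitz's theorem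
(`Complex.hurwitz_eqOn_zero_or_forall_ne_zero`) passes zero-freeness to the limit.
-/

noncomputable section

namespace Summit.CriticalPhenomena.Ising3DConformalLimit.PerfectScreeningCoulombImpliesNontrivial

open Literature.Probability.LatticeModels Filter Set Finset
open scoped Topology BigOperators
open MeasureTheory Literature.Barriers.CriticalPhenomena

variable {d : ℕ}

/-! ### The block spin is a bounded integer of fixed parity -/

/-- The block spin `Σ_{x ∈ B} σ_x` is the cast of the integer `Σ_{x ∈ B} σ_x`. -/
theorem sum_spinAt_eq_intCast {V : Type*} (B : Finset V) (σ : SpinConfig V) :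
    ∑ x ∈ B, spinAt x σ = ((∑ x ∈ B, ((σ x : ℤ)) : ℤ) : ℝ) := by
  simp only [spinAt, Int.cast_sum]

/-- The integer block spin lies in `[-|B|, |B|]` and has the parity of `|B|`. -/
theorem blockInt_mem {V : Type*} (B : Finset V) (σ : SpinConfig V) :
    (∑ x ∈ B, ((σ x : ℤ))) ∈ Finset.Icc (-(#B : ℤ)) (#B) ∧
      (2 : ℤ) ∣ (∑ x ∈ B, ((σ x : ℤ))) + #B := by
  classical
  induction B using Finset.induction_on with
  | empty => simp
  | insert x B hx ih =>
    rw [Finset.sum_insert hx, Finset.card_insert_of_notMem hx]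
    simp only [Finset.mem_Icc, Nat.cast_add, Nat.cast_one] at ih ⊢
    obtain ⟨⟨h1, h2⟩, c, hc⟩ := ih
    rcases Int.units_eq_one_or (σ x) with h | h <;>
      simp only [h, Units.val_one, Units.val_neg] <;> omega

/-- **Any function of the block spin is a finite combination of its level indicators**:
`f(M) = Σ_{|k| ≤ |B|} 1{M = k} • f(k)` pointwise (`f` valued in any real vector space). -/
theorem apply_blockSpin_eq_sum {R : Type*} [AddCommMonoid R] [Module ℝ R] (B : Finset (Site d))
    (σ : SpinConfig (Site d)) (f : ℝ → R) :
    f (∑ x ∈ B, spinAt x σ) = ∑ k ∈ Finset.Icc (-(#B : ℤ)) (#B),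
      (if (∑ x ∈ B, spinAt x σ) = (k : ℝ) then (1 : ℝ) else 0) • f k := by
  rw [sum_spinAt_eq_intCast]
  simp_rw [Int.cast_inj, ite_smul, one_smul, zero_smul]
  rw [Finset.sum_ite_eq_of_mem _ _ _ (blockInt_mem B σ).1]

/-- The level indicators `1{M = c}` of the block spin are measurable. -/
theorem measurable_blockInd (B : Finset (Site d)) (c : ℝ) :
    Measurable (fun σ : SpinConfig (Site d) => if (∑ x ∈ B, spinAt x σ) = c then (1 : ℝ) else 0) :=
  Measurable.ite ((Finset.measurable_sum _ fun x _ => measurable_spinAt x) (measurableSet_singleton c))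
    measurable_const measurable_const

/-- The level indicators are integrable against any finite measure. -/
theorem integrable_blockInd (μ : Measure (SpinConfig (Site d))) [IsFiniteMeasure μ]
    (B : Finset (Site d)) (c : ℝ) :
    Integrable (fun σ : SpinConfig (Site d) => if (∑ x ∈ B, spinAt x σ) = c then (1 : ℝ) else 0) μ :=
  Integrable.of_bound (measurable_blockInd B c).aestronglyMeasurable 1
    (Eventually.of_forall fun σ => by split_ifs <;> simp)

/-! ### The plus state on functions of the block spin -/

/-- `⟨g(M)⟩⁺ = ∫ g(M) dμ` for any finite measure `μ` with the plus correlations. -/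
theorem plusExpect_blockFun_eq_integral {β : ℝ} (hβ : 0 ≤ β)
    {μ : Measure (SpinConfig (Site d))} [IsFiniteMeasure μ]
    (hμ : ∀ A : Finset (Site d), spinCorr μ A = plusCorr d β 0 A) (B : Finset (Site d)) (g : ℝ → ℝ) :
    plusExpect d β 0 (fun σ => g (∑ x ∈ B, spinAt x σ)) = ∫ σ, g (∑ x ∈ B, spinAt x σ) ∂μ :=
  plusExpect_spinFun_eq_integral hβ le_rfl hμ B (fun s => g (∑ x ∈ B, s x))
    (fun _ _ hst => by rw [Finset.sum_congr rfl hst])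

/-- **Nonnegativity**: `⟨1{M = c}⟩⁺ = μ{M = c} ≥ 0`. -/
theorem plusExpect_blockInd_nonneg {β : ℝ} (hβ : 0 ≤ β)
    {μ : Measure (SpinConfig (Site d))} [IsFiniteMeasure μ]
    (hμ : ∀ A : Finset (Site d), spinCorr μ A = plusCorr d β 0 A) (B : Finset (Site d)) (c : ℝ) :
    0 ≤ plusExpect d β 0 (fun σ => if (∑ x ∈ B, spinAt x σ) = c then (1 : ℝ) else 0) := by
  rw [plusExpect_blockFun_eq_integral hβ hμ B (fun t => if t = c then (1 : ℝ) else 0)]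
  exact integral_nonneg fun σ => by
    simp only [Pi.zero_apply]
    split_ifs
    · exact zero_le_one
    · exact le_rfl

/-- **Linearity**: `⟨f(M)⟩⁺ = Σ_k ⟨1{M = k}⟩⁺ f(k)` for every `f : ℝ → ℝ`. -/
theorem plusExpect_blockFun_eq_sum {β : ℝ} (hβ : 0 ≤ β)
    {μ : Measure (SpinConfig (Site d))} [IsFiniteMeasure μ]
    (hμ : ∀ A : Finset (Site d), spinCorr μ A = plusCorr d β 0 A) (B : Finset (Site d)) (f : ℝ → ℝ) :
    plusExpect d β 0 (fun σ => f (∑ x ∈ B, spinAt x σ)) =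
      ∑ k ∈ Finset.Icc (-(#B : ℤ)) (#B),
        plusExpect d β 0 (fun σ => if (∑ x ∈ B, spinAt x σ) = (k : ℝ) then (1 : ℝ) else 0) * f k := by
  have hind := fun c : ℝ => plusExpect_blockFun_eq_integral hβ hμ B (fun t => if t = c then (1 : ℝ) else 0)
  rw [plusExpect_blockFun_eq_integral hβ hμ B f]
  simp_rw [hind]
  have h1 : (fun σ : SpinConfig (Site d) => f (∑ x ∈ B, spinAt x σ)) =
      fun σ => ∑ k ∈ Finset.Icc (-(#B : ℤ)) (#B),
        (if (∑ x ∈ B, spinAt x σ) = (k : ℝ) then (1 : ℝ) else 0) * f k :=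
    funext fun σ => apply_blockSpin_eq_sum B σ f
  rw [h1, integral_finsetSum _ (fun k _ => (integrable_blockInd μ B _).mul_const _)]
  simp_rw [integral_mul_const]

/-- **Total mass**: `Σ_k ⟨1{M = k}⟩⁺ = 1`. -/
theorem sum_plusExpect_blockInd {β : ℝ} (hβ : 0 ≤ β)
    {μ : Measure (SpinConfig (Site d))} [IsFiniteMeasure μ]
    (hμ : ∀ A : Finset (Site d), spinCorr μ A = plusCorr d β 0 A) (B : Finset (Site d)) :
    ∑ k ∈ Finset.Icc (-(#B : ℤ)) (#B),
      plusExpect d β 0 (fun σ => if (∑ x ∈ B, spinAt x σ) = (k : ℝ) then (1 : ℝ) else 0) = 1 := by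
  have h := plusExpect_blockFun_eq_sum hβ hμ B (fun _ => 1)
  simp only [mul_one, plusExpect_const] at h
  exact h.symm

/-- **Parity**: `⟨1{M = k}⟩⁺ = 0` unless `k ≡ |B| (mod 2)` (the indicator vanishes identically). -/
theorem plusExpect_blockInd_eq_zero_of_not_dvd (β : ℝ) (B : Finset (Site d)) {k : ℤ}
    (hk : ¬ (2 ∣ (k + #B))) :
    plusExpect d β 0 (fun σ => if (∑ x ∈ B, spinAt x σ) = (k : ℝ) then (1 : ℝ) else 0) = 0 := by
  have h : (fun σ : SpinConfig (Site d) => if (∑ x ∈ B, spinAt x σ) = (k : ℝ) then (1 : ℝ) else 0) =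
      fun _ => 0 := by
    funext σ
    rw [if_neg]
    rw [sum_spinAt_eq_intCast, Int.cast_inj]
    intro hσ
    rw [← hσ] at hk
    exact hk (blockInt_mem B σ).2
  rw [h, plusExpect_const]

/-- A function of the spins in a finite `D` is a finite linear combination of spin products
(`exists_localObs_eq_sum_spinProduct`, field form). -/
theorem spinFun_eq_sum_spinProduct (D : Finset (Site d)) (Φ : (Site d → ℝ) → ℝ)
    (hΦ : ∀ s t : Site d → ℝ, (∀ x ∈ D, s x = t x) → Φ s = Φ t) :
    ∃ c : Finset ↥D → ℝ, ∀ σ : SpinConfig (Site d), Φ (fun x => spinAt x σ) =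
      ∑ A : Finset ↥D, c A * spinProduct (A.map (Function.Embedding.subtype (· ∈ D))) σ := by
  classical
  obtain ⟨c, hc⟩ := exists_localObs_eq_sum_spinProduct D
    (fun η => Φ (fun x => if hx : x ∈ D then ((η ⟨x, hx⟩ : ℤ) : ℝ) else 1))
  exact ⟨c, fun σ => by rw [← hc σ]; exact hΦ _ _ fun x hx => by simp [hx, spinAt]⟩

/-- **The plus state is even on local observables when `m*(β) = 0`**: for `Φ` depending on finitely
many spins, `⟨Φ(-σ)⟩⁺_{β,0} = ⟨Φ(σ)⟩⁺_{β,0}` (expand in spin products; odd plus correlations vanish,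
`plusCorr_eq_zero_of_odd_card`). -/
theorem plusExpect_spinFun_neg {β : ℝ} (hβ : 0 ≤ β) (hm : spontaneousMagnetization d β = 0)
    (D : Finset (Site d)) (Φ : (Site d → ℝ) → ℝ)
    (hΦ : ∀ s t : Site d → ℝ, (∀ x ∈ D, s x = t x) → Φ s = Φ t) :
    plusExpect d β 0 (fun σ => Φ (fun x => -spinAt x σ)) =
      plusExpect d β 0 (fun σ => Φ (fun x => spinAt x σ)) := by
  obtain ⟨c, hc⟩ := spinFun_eq_sum_spinProduct D Φ hΦ
  have hneg : ∀ σ : SpinConfig (Site d), Φ (fun x => -spinAt x σ) =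
      ∑ A : Finset ↥D, (c A * (-1) ^ #(A.map (Function.Embedding.subtype (· ∈ D)))) *
        spinProduct (A.map (Function.Embedding.subtype (· ∈ D))) σ := fun σ => by
    simp_rw [← spinAt_neg, hc (-σ), spinProduct_neg, mul_assoc]
  simp_rw [hneg, hc, plusExpect_sum_spinProduct hβ le_rfl]
  refine Finset.sum_congr rfl fun A _ => ?_
  rcases Nat.even_or_odd #(A.map (Function.Embedding.subtype (· ∈ D))) with he | ho
  · rw [he.neg_one_pow, mul_one]
  · rw [plusCorr_eq_zero_of_odd_card hβ hm ho, mul_zero, mul_zero]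

/-- **Symmetry**: `⟨1{M = -k}⟩⁺ = ⟨1{M = k}⟩⁺` when `m*(β) = 0`. -/
theorem plusExpect_blockInd_neg {β : ℝ} (hβ : 0 ≤ β) (hm : spontaneousMagnetization d β = 0)
    (B : Finset (Site d)) (k : ℤ) :
    plusExpect d β 0 (fun σ => if (∑ x ∈ B, spinAt x σ) = ((-k : ℤ) : ℝ) then (1 : ℝ) else 0) =
      plusExpect d β 0 (fun σ => if (∑ x ∈ B, spinAt x σ) = (k : ℝ) then (1 : ℝ) else 0) := by
  have h := plusExpect_spinFun_neg hβ hm B (fun s => if (∑ x ∈ B, s x) = (k : ℝ) then (1 : ℝ) else 0)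
    (fun _ _ hst => by rw [Finset.sum_congr rfl hst])
  simp only [Finset.sum_neg_distrib, neg_eq_iff_eq_neg] at h
  rw [Int.cast_neg]
  exact h

/-! ### Free boxes: finite ferromagnetic pair-interaction systems (Lee–Yang) -/

/-- The block spin of a glued configuration, read on the volume: for `B ⊆ Λ`,
`Σ_{x ∈ B} σ_x(τ·bc) = Σ_{a ∈ Λ} 1{a ∈ B} τ_a`. -/
theorem sum_spinAt_glue_eq {Λ B : Finset (Site d)} (hB : B ⊆ Λ) (τ : ↥Λ → ℤˣ)
    (bc : BoundaryCondition (Site d)) :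
    ∑ x ∈ B, spinAt x (glue Λ τ bc) = ∑ a : ↥Λ, (if (a : Site d) ∈ B then (1 : ℝ) else 0) * spinAt a τ := by
  classical
  simp_rw [← spinAt_glue_coe τ bc, boole_mul]
  rw [Finset.sum_coe_sort Λ (fun x => if x ∈ B then spinAt x (glue Λ τ bc) else 0), Finset.sum_ite_mem,
    Finset.inter_eq_right.2 hB]

/-- The Boolean code (`NewmanLeeYang.cfgEquiv`) of a `±1` configuration has the same spins. -/
theorem spinVal_cfgEquiv {ι : Type*} {n : ℕ} (e : ι ≃ Fin n) (ρ : SpinConfig ι) (i : Fin n) :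
    spinVal (NewmanLeeYang.cfgEquiv e ρ) i = spinAt (e.symm i) ρ := by
  unfold spinVal
  simp only [NewmanLeeYang.cfgEquiv, Equiv.coe_fn_mk, NewmanLeeYang.boolOfUnit, spinAt]
  rcases Int.units_eq_one_or (ρ (e.symm i)) with h | h <;> simp [h]

/-- **The free box with a complex field on the block is a Lee–Yang partition function**: for
`B ⊆ Λ` and `β ≥ 0` there are pair couplings `J ≥ 0` and weights `w ≥ 0` on `Fin |Λ|`
(`J = β/2 · 1{x ∼ y}`, `w = 1_B`, transported along `NewmanLeeYang.cfgEquiv`) with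
`Σ_τ e^{-βH^∅_Λ(τ)} e^{z M_B(τ)} = isingFieldPartition J w z` for all `z`. -/
theorem exists_isingFieldPartition_eq {β : ℝ} (hβ : 0 ≤ β) {Λ B : Finset (Site d)} (hB : B ⊆ Λ) :
    ∃ (n : ℕ) (J : Fin n → Fin n → ℝ) (wv : Fin n → ℝ), (∀ i j, 0 ≤ J i j) ∧ (∀ i, 0 ≤ wv i) ∧
      ∀ z : ℂ, ∑ τ : (↥Λ → ℤˣ), (isingWeight (zdGraph d) Λ β 0 .free τ : ℂ) *
          Complex.exp (z * ((∑ x ∈ B, spinAt x (glue Λ τ .free) : ℝ) : ℂ)) =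
        isingFieldPartition J wv z := by
  classical
  set e := Fintype.equivFin ↥Λ
  refine ⟨_, fun i j => if (zdGraph d).Adj (e.symm i) (e.symm j) then β / 2 else 0,
    fun i => if ((e.symm i : ↥Λ) : Site d) ∈ B then 1 else 0,
    fun i j => by dsimp only; split_ifs <;> positivity, fun i => by dsimp only; split_ifs <;> norm_num,
    fun z => ?_⟩
  refine Fintype.sum_equiv (NewmanLeeYang.cfgEquiv e) _ _ fun τ => ?_
  have h1 : isingBoltzmann (fun i j => if (zdGraph d).Adj (e.symm i) (e.symm j) then β / 2 else 0)
      (NewmanLeeYang.cfgEquiv e τ) = isingWeight (zdGraph d) Λ β 0 .free τ := by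
    rw [← PairIsing.weight_adj_eq_isingWeight, PairIsing.weight, isingBoltzmann, isingPairEnergy,
      ← Equiv.sum_comp e.symm]
    simp_rw [spinVal_cfgEquiv]
    refine congrArg Real.exp (Finset.sum_congr rfl fun i _ => ?_)
    rw [← Equiv.sum_comp e.symm]
    exact Finset.sum_congr rfl fun j _ => by ring
  have h2 : weightedMagnetization (fun i => if ((e.symm i : ↥Λ) : Site d) ∈ B then (1 : ℝ) else 0)
      (NewmanLeeYang.cfgEquiv e τ) = ∑ x ∈ B, spinAt x (glue Λ τ .free) := by
    rw [sum_spinAt_glue_eq hB, weightedMagnetization,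
      ← Equiv.sum_comp e.symm (fun a : ↥Λ => (if (a : Site d) ∈ B then (1 : ℝ) else 0) * spinAt a τ)]
    simp_rw [spinVal_cfgEquiv]
  rw [h1, h2]

/-- **Lee–Yang for the block-spin law of a free box**: for `B ⊆ Λ`, `β ≥ 0` and `Re z ≠ 0`,
`Σ_k ⟨1{M_B = k}⟩^∅_{Λ;β,0} e^{zk} ≠ 0` (`= Σ_τ w(τ) e^{zM_B(τ)} / Z`, zero-free by
`lee_yang_ising_holds`). -/
theorem sum_isingExpect_blockInd_mul_cexp_ne_zero {β : ℝ} (hβ : 0 ≤ β) {Λ B : Finset (Site d)}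
    (hB : B ⊆ Λ) {z : ℂ} (hz : z.re ≠ 0) :
    ∑ k ∈ Finset.Icc (-(#B : ℤ)) (#B),
      (isingExpect (zdGraph d) Λ β 0 .free
          (fun σ => if (∑ x ∈ B, spinAt x σ) = (k : ℝ) then (1 : ℝ) else 0) : ℂ) *
        Complex.exp (z * (k : ℂ)) ≠ 0 := by
  classical
  obtain ⟨n, J, wv, hJ, hwv, hZ⟩ := exists_isingFieldPartition_eq (d := d) hβ hB
  have hq : ∀ k : ℤ, isingExpect (zdGraph d) Λ β 0 .free
      (fun σ => if (∑ x ∈ B, spinAt x σ) = (k : ℝ) then (1 : ℝ) else 0) =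
      (∑ τ : (↥Λ → ℤˣ), isingWeight (zdGraph d) Λ β 0 .free τ *
        (if (∑ x ∈ B, spinAt x (glue Λ τ .free)) = (k : ℝ) then (1 : ℝ) else 0)) /
        isingPartitionFunction (zdGraph d) Λ β 0 .free := fun k =>
    isingExpect_eq_sum_div _ _ _ _ _ (measurable_blockInd B _)
  -- pointwise `Σ_k 1{M = k} e^{zk} = e^{zM}`
  have hexp : ∀ σ : SpinConfig (Site d), ∑ k ∈ Finset.Icc (-(#B : ℤ)) (#B),
      ((if (∑ x ∈ B, spinAt x σ) = (k : ℝ) then (1 : ℝ) else 0 : ℝ) : ℂ) * Complex.exp (z * (k : ℂ)) =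
      Complex.exp (z * ((∑ x ∈ B, spinAt x σ : ℝ) : ℂ)) := fun σ => by
    have h := (apply_blockSpin_eq_sum B σ (fun t : ℝ => Complex.exp (z * (t : ℂ)))).symm
    simp_rw [Complex.real_smul, Complex.ofReal_intCast] at h
    exact h
  have key : ∑ k ∈ Finset.Icc (-(#B : ℤ)) (#B),
      (isingExpect (zdGraph d) Λ β 0 .free
          (fun σ => if (∑ x ∈ B, spinAt x σ) = (k : ℝ) then (1 : ℝ) else 0) : ℂ) *
        Complex.exp (z * (k : ℂ)) =
      isingFieldPartition J wv z / (isingPartitionFunction (zdGraph d) Λ β 0 .free : ℂ) := by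
    simp_rw [hq]
    push_cast
    simp_rw [div_mul_eq_mul_div, ← Finset.sum_div, Finset.sum_mul]
    rw [Finset.sum_comm]
    simp_rw [mul_assoc, ← Finset.mul_sum, hexp]
    rw [← hZ z]
  rw [key]
  exact div_ne_zero (lee_yang_ising_holds _ J wv hJ hwv z hz)
    (Complex.ofReal_ne_zero.2 (isingPartitionFunction_pos _ _ _ _ _).ne')

/-- **Free-box states converge to the plus state on local observables when `m*(β) = 0`**
(`⟨σ_A⟩^∅_{B(N)} → ⟨σ_A⟩⁺`, `hasBoxLimit_isingCorr_of_spontaneousMagnetization_eq_zero`, and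
linearity on the span of spin products). -/
theorem tendsto_isingExpect_free_spinFun {β : ℝ} (hβ : 0 ≤ β) (hm : spontaneousMagnetization d β = 0)
    (D : Finset (Site d)) (Φ : (Site d → ℝ) → ℝ)
    (hΦ : ∀ s t : Site d → ℝ, (∀ x ∈ D, s x = t x) → Φ s = Φ t) :
    Tendsto (fun N : ℕ => isingExpect (zdGraph d) (box d N) β 0 .free
      (fun σ => Φ (fun x => spinAt x σ))) atTop
      (𝓝 (plusExpect d β 0 (fun σ => Φ (fun x => spinAt x σ)))) := by
  obtain ⟨c, hc⟩ := spinFun_eq_sum_spinProduct D Φ hΦ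
  simp_rw [hc]
  rw [plusExpect_sum_spinProduct hβ le_rfl]
  simp_rw [isingExpect_sum_spinProduct]
  exact tendsto_finsetSum _ fun A _ =>
    (hasBoxLimit_isingCorr_of_spontaneousMagnetization_eq_zero hβ hm _ .free (by simp)).const_mul _

/-! ### Hurwitz: zero-freeness off the axis passes to the limit of lattice laws -/

/-- **Limits of lattice Lee–Yang laws are Lee–Yang.** If finitely supported laws `q_N` on a fixed
finite `S ⊂ ℤ` have Laplace transforms `Σ_k q_N(k) e^{zk}` zero-free off the imaginary axis
(eventually in `N`) and `q_N → p` pointwise with `p ≥ 0`, `Σ_S p = 1`, then every zero of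
`Σ_k p_k e^{zk}` is purely imaginary: the transforms are a jointly continuous function of
(coefficients, `z`), hence converge locally uniformly (`ContinuousMap.tendsto_iff_tendstoLocallyUniformly`);
Hurwitz (`Complex.hurwitz_eqOn_zero_or_forall_ne_zero`) on each half plane; positivity at real points. -/
theorem re_eq_zero_of_limit_laplace {S : Finset ℤ} {q : ℕ → ℤ → ℝ} {p : ℤ → ℝ}
    (hq : ∀ᶠ N in atTop, ∀ z : ℂ, z.re ≠ 0 →
      ∑ k ∈ S, (q N k : ℂ) * Complex.exp (z * (k : ℂ)) ≠ 0)
    (hlim : ∀ k, Tendsto (fun N => q N k) atTop (𝓝 (p k)))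
    (hp : ∀ k, 0 ≤ p k) (hp1 : ∑ k ∈ S, p k = 1) {z : ℂ}
    (hz : ∑ k ∈ S, (p k : ℂ) * Complex.exp (z * (k : ℂ)) = 0) : z.re = 0 := by
  have hΦ : Continuous (fun cz : (ℤ → ℝ) × ℂ =>
      ∑ k ∈ S, (cz.1 k : ℂ) * Complex.exp (cz.2 * (k : ℂ))) := by
    fun_prop
  set Φ : C((ℤ → ℝ) × ℂ, ℂ) := ⟨_, hΦ⟩
  have hloc : TendstoLocallyUniformly (fun N w => Φ.curry (q N) w) (Φ.curry p) atTop :=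
    ContinuousMap.tendsto_iff_tendstoLocallyUniformly.1
      ((Φ.curry.continuous.tendsto p).comp (tendsto_pi_nhds.2 hlim))
  have hdiff : ∀ N, Differentiable ℂ (fun w => Φ.curry (q N) w) := fun N => by
    show Differentiable ℂ (fun w => ∑ k ∈ S, (q N k : ℂ) * Complex.exp (w * (k : ℂ)))
    fun_prop
  have hreal : ∀ x : ℝ, Φ.curry p x ≠ 0 := by
    intro x
    have hpos : 0 < ∑ k ∈ S, p k * Real.exp (x * k) := by
      obtain ⟨k, hk, hpk⟩ : ∃ k ∈ S, p k ≠ 0 :=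
        Finset.exists_ne_zero_of_sum_ne_zero (by rw [hp1]; exact one_ne_zero)
      exact Finset.sum_pos' (fun k _ => mul_nonneg (hp k) (Real.exp_pos _).le)
        ⟨k, hk, mul_pos ((hp k).lt_of_ne' hpk) (Real.exp_pos _)⟩
    have hfx : Φ.curry p x = ((∑ k ∈ S, p k * Real.exp (x * k) : ℝ) : ℂ) := by
      show ∑ k ∈ S, (p k : ℂ) * Complex.exp (x * (k : ℂ)) = _
      push_cast
      rfl
    rw [hfx]
    exact_mod_cast hpos.ne'
  have key : ∀ U : Set ℂ, IsOpen U → IsPreconnected U → (∀ w ∈ U, w.re ≠ 0) →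
      ∀ x : ℝ, (x : ℂ) ∈ U → z ∉ U := by
    intro U hUo hUc hUsub x hx hzU
    rcases Complex.hurwitz_eqOn_zero_or_forall_ne_zero hUo hUc
        (Eventually.of_forall fun N => (hdiff N).differentiableOn)
        ((tendstoLocallyUniformlyOn_univ.2 hloc).mono (subset_univ U))
        ((hq.mono fun N hN w hwU => hN w (hUsub w hwU)).frequently) with h | h
    · exact hreal x (h hx)
    · exact h z hzU hz
  by_contra hne
  rcases lt_or_gt_of_ne hne with hlt | hgt
  · exact key {w | w.re < 0} (isOpen_lt Complex.continuous_re continuous_const)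
      (convex_halfSpace_re_lt 0).isPreconnected (fun w hw => ne_of_lt hw) (-1)
      (show ((-1 : ℝ) : ℂ) ∈ {w : ℂ | w.re < 0} by simp) hlt
  · exact key {w | 0 < w.re} (isOpen_lt continuous_const Complex.continuous_re)
      (convex_halfSpace_re_gt 0).isPreconnected (fun w hw => ne_of_gt hw) 1
      (show ((1 : ℝ) : ℂ) ∈ {w : ℂ | 0 < w.re} by simp) hgt

/-! ### The registered stub -/

/-- S1a — **THE CRITICAL BLOCK-SPIN LAW IS A LEE–YANG PMF.** For every `L`, with `K = (2L+1)³` and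
`M_L = Σ_{x ∈ box 3 L} σ_x`: there is `p : ℤ → ℝ`, `p ≥ 0`, symmetric, vanishing off the parity class
of `K`, of total mass `1` on `[-K, K]`, such that `⟨f(M_L)⟩_{β_c} = Σ_{|k| ≤ K} p_k f(k)` for EVERY
`f : ℝ → ℝ`, and the Laplace transform `z ↦ Σ p_k e^{zk}` has only purely imaginary zeros. Here
`p_k = ⟨1{M_L = k}⟩⁺_{β_c(3),0}` (plus Gibbs measure `exists_plusMeasure_holds`; symmetry from
`m*(β_c) = 0`; Lee–Yang from the free boxes `Λ_N ⊇ box 3 L`, `lee_yang_ising_holds`, their convergence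
to the plus state at `β_c`, and Hurwitz's theorem, `re_eq_zero_of_limit_laplace`). -/
theorem stub_blockLaw :
    ∀ L : ℕ, ∃ p : ℤ → ℝ, (∀ k, 0 ≤ p k) ∧ (∀ k, p (-k) = p k) ∧
      (∀ k : ℤ, ¬ (2 ∣ (k + ((2 * L + 1) ^ 3 : ℕ))) → p k = 0) ∧
      (∑ k ∈ Finset.Icc (-(((2 * L + 1) ^ 3 : ℕ) : ℤ)) ((2 * L + 1) ^ 3 : ℕ), p k = 1) ∧
      (∀ f : ℝ → ℝ, plusExpect 3 (criticalBeta 3) 0 (fun σ => f (∑ x ∈ box 3 L, spinAt x σ)) =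
        ∑ k ∈ Finset.Icc (-(((2 * L + 1) ^ 3 : ℕ) : ℤ)) ((2 * L + 1) ^ 3 : ℕ), p k * f k) ∧
      (∀ z : ℂ, (∑ k ∈ Finset.Icc (-(((2 * L + 1) ^ 3 : ℕ) : ℤ)) ((2 * L + 1) ^ 3 : ℕ),
          (p k : ℂ) * Complex.exp (z * (k : ℂ))) = 0 → z.re = 0) := by
  intro L
  rw [← card_box 3 L]
  have hβ : 0 ≤ criticalBeta 3 := criticalBeta_nonneg 3
  have hm : spontaneousMagnetization 3 (criticalBeta 3) = 0 :=
    spontaneousMagnetization_criticalBeta_eq_zero_holds (d := 3) le_rfl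
  obtain ⟨μ, hμG, -, hμ⟩ :=
    exists_plusMeasure_holds (d := 3) (β := criticalBeta 3) (h := (0 : ℝ)) hβ
  haveI : IsProbabilityMeasure μ :=
    ((mem_isingGibbsMeasures_iff 3 _ 0 μ).1 hμG).isProbabilityMeasure
  refine ⟨fun k => plusExpect 3 (criticalBeta 3) 0
      (fun σ => if (∑ x ∈ box 3 L, spinAt x σ) = (k : ℝ) then (1 : ℝ) else 0),
    fun k => plusExpect_blockInd_nonneg hβ hμ _ k, fun k => plusExpect_blockInd_neg hβ hm _ k,
    fun k hk => plusExpect_blockInd_eq_zero_of_not_dvd _ _ hk, sum_plusExpect_blockInd hβ hμ _,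
    fun f => plusExpect_blockFun_eq_sum hβ hμ _ f, fun z hz => ?_⟩
  obtain ⟨N₀, hN₀⟩ := exists_forall_subset_box _ (box 3 L)
  refine re_eq_zero_of_limit_laplace
    (q := fun N k => isingExpect (zdGraph 3) (box 3 N) (criticalBeta 3) 0 .free
      (fun σ => if (∑ x ∈ box 3 L, spinAt x σ) = (k : ℝ) then (1 : ℝ) else 0)) ?_
    (fun k => tendsto_isingExpect_free_spinFun hβ hm (box 3 L)
      (fun s => if (∑ x ∈ box 3 L, s x) = (k : ℝ) then (1 : ℝ) else 0)
      (fun _ _ hst => by rw [Finset.sum_congr rfl hst]))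
    (fun k => plusExpect_blockInd_nonneg hβ hμ _ k) (sum_plusExpect_blockInd hβ hμ _) hz
  filter_upwards [eventually_ge_atTop N₀] with N hN
  exact fun w hw => sum_isingExpect_blockInd_mul_cexp_ne_zero hβ (hN₀ N hN) hw

end Summit.CriticalPhenomena.Ising3DConformalLimit.PerfectScreeningCoulombImpliesNontrivial

end
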